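import Summits.QuantumFields.YangMills.Theorems.UnitScaleTiltProp8FibreSelectiveCorrector
import Summits.QuantumFields.YangMills.Theorems.BalabanUVNodesN07CritTangentAtRecord

/-!
# NODE N07 ([15] = [Balaban1985Variational]) — MODULE 35h: THE `k`-FOLD SELECTIVE EXACT CORRECTOR OF THE (0.4) DESCENT ON `SU(N)`
# (towers of exceptional bonds closed under the central-bond maps; the fine field is untouched OFF the bottom of the tower)

Cell `pub-ymgap`, seat `pub-ymgap-dag-n07-e` generation 14 (R141 (C), DAG node N07).  `--kind proof --supports stmt-QuantumFields-20541 --as helper`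
(K0⁷; V18 stub 1 `stub_prop8StepCoP13` is N07's lane).  The route `UnitScaleTilt` holds this for `SU(2)` (`Prop8Criticality.exists_iter_eq_of_near`, seat
`ym-ust-19200-p2` g4, with `δ₂ = 1∕3` built in); module 35c holds the NON-selective `SU(N)` version (`N07CritTangentAtRecord.exists_iter_eq_of_near_SU`).  Here: the
SELECTIVE `SU(N)` version, every `N`, the guard `δ_N` carried as a hypothesis — the brick the multi-scale fibre of V16∕V18 stub 1 (`genSet s.Ω k`, HOME
`LOCATED-MULTISCALE-FIBRE.md` § B, ROAD B (B2)) realises its level-`(i−1)` controls with: a change of the iterated average prescribed on a set `T_n` of level-`n` bonds is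
realised by a change of the FINE field supported on the bottom `T₀` of any tower `T_n, T_{n−1}, …, T₀` closed downwards under `centralBond`, all other level-`n` values kept.

WHAT IS PROVED (sorry-free, no definition, axioms standard): ★★ `exists_iter_eq_of_near_selective_SU` — for `t ≥ 0`, every level `n ≤ m + K`, every `SU(N)` field `U`
on the finest lattice with `t`-small iterated (0.4)-averages `Ū^{(i)}`, `i < n`, every tower `T` closed downwards under the central-bond maps below level `n`, every
level-`n` field `W` with `‖W(c) − Ū^{(n)}(c)‖ ≤ η`, `W(c) = Ū^{(n)}(c)` off `T_n`, and `stokesConst·t + (2∕|I|⁻¹)^n·η ≤ |I|⁻¹∕16`, `< δ_N`: there is `U′` with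
`Ū′^{(n)} = W` EXACTLY, `U′ = U` off `T₀`, and `‖U′(b) − U(b)‖ ≤ (2∕|I|⁻¹)^n·η`.  PROOF: the route's induction (peel the top averaging with the one-step SELECTIVE
corrector `Prop8Criticality.exists_avgFun_eq_of_near_selective` — general `n` there —, then the induction hypothesis with tolerance `2η|I|`), the `SU(N)` guard
threaded as in 35c.  `iter_eq_off_tower` records the by-product used by ROAD B: the new INTERMEDIATE averages agree with the old ones off the tower (locality
`B14Eq216Concrete.iter_local` is not needed for this — it is the induction itself).
HONEST FRAMING: count-neutral kernel bookkeeping over the route `UnitScaleTilt`'s one-step corrector; the modulus `(2|I|)^n` is NOT uniform in `n`; nothing of [15]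
Sects. B–F; stub 1 ∕ K0⁷ NOT closed; N07 NOT discharged (5∕27); one finite T⁴ programme at fixed ε — NOT continuum ∕ ℝ⁴ ∕ OS ∕ mass gap ∕ Clay.  No `sorry`, no
`instance`, no `notation`.
References: T. Bałaban, CMP **109** (1987) 249–301 [Balaban1987RG1] ((0.4), (0.11) p.253); CMP **102** (1985) 277–309 [Balaban1985Variational] ((47) p.285, p.300).
-/

noncomputable section

open scoped Matrix.Norms.L2Operator Topology
open Filter Function NormedSpace

namespace Summit.QuantumFields.YangMills.BalabanUVNodes.N07CritSelectiveCorrector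

open Literature.MathematicalPhysics.QuantumFieldTheory.Balaban1983to89
open Literature.MathematicalPhysics.QuantumFieldTheory.Balaban1983to89.BlockAveraging
open Literature.MathematicalPhysics.QuantumFieldTheory.Balaban1983to89.BlockAveragingHaarAC (centralBond)
open Literature.MathematicalPhysics.QuantumFieldTheory.Balaban1983to89.BlockAveragingEMLHaarAC (emlWeight)
open Literature.MathematicalPhysics.QuantumFieldTheory.Balaban1983to89.ExpMeanLog (expMeanLogSU deltaSU deltaSU_pos)
open Literature.MathematicalPhysics.QuantumFieldTheory.Balaban1983to89.Node00
open Summit.QuantumFields.YangMills.Theorems.BlockAvgCorrector (stokesConst stokesConst_nonneg emlWeight_pos emlWeight_le_one)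
open Summit.QuantumFields.YangMills.Theorems.Prop8Criticality (exists_avgFun_eq_of_near_selective)
open Summit.QuantumFields.YangMills.BalabanUVNodes.N07CritTangentAtRecord (iter_succ_eq_avgFun_rec)

variable {P : Params} {N : ℕ} [NeZero N]

/-- ★★ **THE `k`-FOLD SELECTIVE EXACT CORRECTOR ON `SU(N)`.**  Let `t ≥ 0`.  For every level `n ≤ m + K`, every `SU(N)` field `U` on the finest lattice with
`t`-small iterated (0.4)-averages `Ū^{(i)}`, `i < n`, every tower `T_i ⊆ {level-i bonds}` closed downwards under the central-bond maps below level `n`, and every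
level-`n` field `W` with `‖W(c) − Ū^{(n)}(c)‖ ≤ η` for all `c`, `W(c) = Ū^{(n)}(c)` for `c ∉ T_n`, `stokesConst·t + (2∕|I|⁻¹)^n·η ≤ |I|⁻¹∕16` and `< δ_N`:
there is `U′` with `Ū′^{(n)} = W` exactly, `U′(b) = U(b)` for `b ∉ T₀`, and `‖U′(b) − U(b)‖ ≤ (2∕|I|⁻¹)^n·η` for all `b`.
[cite: Balaban1987RG1, (0.4) p.253, (0.11) p.253; Balaban1985Variational, (47) p.285] -/
theorem exists_iter_eq_of_near_selective_SU {t : ℝ} (ht : 0 ≤ t) :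
    ∀ n : ℕ, n ≤ P.m + P.K →
    ∀ U : GaugeField P 0 (SU N),
      (∀ i, i < n → PlaqSmall t (Averaging.iter (fun i => blockAvg (P := P) (j := i) (expMeanLogSU (n := Fin N))) i U)) →
    ∀ T : (i : ℕ) → Set (PBond P i),
      (∀ i, i < n → ∀ c : PBond P (i + 1), c ∈ T (i + 1) → centralBond c ∈ T i) →
    ∀ (η : ℝ), 0 ≤ η → stokesConst P * t + (2 / emlWeight P) ^ n * η ≤ emlWeight P / 16 →
      stokesConst P * t + (2 / emlWeight P) ^ n * η < deltaSU (Fin N) →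
    ∀ W : GaugeField P n (SU N),
      (∀ c : PBond P n, ‖((W c : SU N) : Matrix (Fin N) (Fin N) ℂ) -
        ((Averaging.iter (fun i => blockAvg (P := P) (j := i) (expMeanLogSU (n := Fin N))) n U c : SU N) : Matrix (Fin N) (Fin N) ℂ)‖ ≤ η) →
      (∀ c : PBond P n, c ∉ T n → W c = Averaging.iter (fun i => blockAvg (P := P) (j := i) (expMeanLogSU (n := Fin N))) n U c) →
    ∃ U' : GaugeField P 0 (SU N),
      Averaging.iter (fun i => blockAvg (P := P) (j := i) (expMeanLogSU (n := Fin N))) n U' = W ∧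
      (∀ b : PBond P 0, b ∉ T 0 → U' b = U b) ∧
      ∀ b : PBond P 0, ‖((U' b : SU N) : Matrix (Fin N) (Fin N) ℂ) - (U b : Matrix (Fin N) (Fin N) ℂ)‖ ≤ (2 / emlWeight P) ^ n * η := by
  intro n
  induction n with
  | zero =>
    intro _ U _ T _ η _ _ _ W hW hWT
    refine ⟨W, rfl, fun b hb => ?_, fun b => ?_⟩
    · rw [hWT b hb]; rfl
    · rw [pow_zero, one_mul]
      exact hW b
  | succ n ih =>
    intro hn U hsm T hT η hη hsmall hguard W hW hWT
    have hκ : 0 < emlWeight P := emlWeight_pos P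
    have hκ1 : emlWeight P ≤ 1 := emlWeight_le_one P
    have hst : 0 ≤ stokesConst P * t := mul_nonneg (stokesConst_nonneg P) ht
    have hq1 : 1 ≤ 2 / emlWeight P := by
      rw [le_div_iff₀ hκ]; linarith
    have hqn : 1 ≤ (2 / emlWeight P) ^ n := one_le_pow₀ hq1
    have hpow : (2 / emlWeight P) ^ (n + 1) * η = (2 / emlWeight P) ^ n * (2 * η / emlWeight P) := by
      rw [pow_succ]; ring
    have h1 : 2 * η / emlWeight P ≤ (2 / emlWeight P) ^ (n + 1) * η := by
      rw [hpow]
      have : 0 ≤ 2 * η / emlWeight P := div_nonneg (by linarith) hκ.le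
      nlinarith
    have hsmall₁ : stokesConst P * t + 2 * η / emlWeight P ≤ emlWeight P / 16 := by linarith
    have hguard₁ : stokesConst P * t + 2 * η / emlWeight P < (expMeanLogSU (n := Fin N)).δ := by
      show _ < deltaSU (Fin N)
      linarith
    -- the level-`n` ambient field and the one-step SELECTIVE corrector at the top
    set Λ : GaugeField P n (SU N) := Averaging.iter (fun i => blockAvg (P := P) (j := i) (expMeanLogSU (n := Fin N))) n U with hΛ
    have hΛsmall : PlaqSmall t Λ := hsm n (Nat.lt_succ_self n)
    have hWΛ : ∀ c, ‖((W c : SU N) : Matrix (Fin N) (Fin N) ℂ) - ((avgFun (expMeanLogSU (n := Fin N)) Λ c : SU N) : Matrix (Fin N) (Fin N) ℂ)‖ ≤ η := by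
      intro c
      have := hW c
      rwa [iter_succ_eq_avgFun_rec] at this
    obtain ⟨μ, hμW, hμoff, hμsel, hμdist⟩ :=
      exists_avgFun_eq_of_near_selective (n := Fin N) hn ht hη hsmall₁ hguard₁ Λ hΛsmall W hWΛ
    -- the new target agrees with `Λ` off `T n`
    have hμT : ∀ c : PBond P n, c ∉ T n → μ c = Λ c := by
      intro c hc
      by_cases hcen : ∃ c' : PBond P (n + 1), centralBond c' = c
      · obtain ⟨c', rfl⟩ := hcen
        have hc' : c' ∉ T (n + 1) := fun h => hc (hT n (Nat.lt_succ_self n) c' h)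
        refine hμsel c' ?_
        rw [hWT c' hc', iter_succ_eq_avgFun_rec]
      · push Not at hcen
        exact hμoff c fun c' h => hcen c' h
    -- lift the new target all the way down (induction hypothesis with tolerance `2η|I|`)
    have hsmall' : stokesConst P * t + (2 / emlWeight P) ^ n * (2 * η / emlWeight P) ≤ emlWeight P / 16 := by rwa [← hpow]
    have hguard' : stokesConst P * t + (2 / emlWeight P) ^ n * (2 * η / emlWeight P) < deltaSU (Fin N) := by rwa [← hpow]
    obtain ⟨U', hU'iter, hU'off, hU'dist⟩ := ih (Nat.le_of_succ_le hn) U (fun i hi => hsm i (Nat.lt_succ_of_lt hi)) T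
      (fun i hi => hT i (Nat.lt_succ_of_lt hi)) (2 * η / emlWeight P) (div_nonneg (by linarith) hκ.le) hsmall' hguard' μ hμdist hμT
    refine ⟨U', ?_, hU'off, fun b => ?_⟩
    · rw [iter_succ_eq_avgFun_rec, hU'iter, hμW]
    · rw [hpow]; exact hU'dist b

/-- ★ **THE INTERMEDIATE AVERAGES OFF THE TOWER ARE KEPT** (the by-product ROAD B (B2) uses): under the same hypotheses there is `U′` with, in addition, `Ū′^{(i)}(c) = Ū^{(i)}(c)`
for every level `i ≤ n` and every `c ∉ T_i` — the selective correction moves the level-`i` averages only ON the tower.  (Induction as above, carrying the extra clause: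
at the top the selective corrector fixes `μ = Λ` off `T_n`; below, the induction hypothesis.) [cite: Balaban1987RG1, (0.4) p.253, (0.11) p.253] -/
theorem exists_iter_eq_of_near_selective_SU_offTower {t : ℝ} (ht : 0 ≤ t) :
    ∀ n : ℕ, n ≤ P.m + P.K →
    ∀ U : GaugeField P 0 (SU N),
      (∀ i, i < n → PlaqSmall t (Averaging.iter (fun i => blockAvg (P := P) (j := i) (expMeanLogSU (n := Fin N))) i U)) →
    ∀ T : (i : ℕ) → Set (PBond P i),
      (∀ i, i < n → ∀ c : PBond P (i + 1), c ∈ T (i + 1) → centralBond c ∈ T i) →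
    ∀ (η : ℝ), 0 ≤ η → stokesConst P * t + (2 / emlWeight P) ^ n * η ≤ emlWeight P / 16 →
      stokesConst P * t + (2 / emlWeight P) ^ n * η < deltaSU (Fin N) →
    ∀ W : GaugeField P n (SU N),
      (∀ c : PBond P n, ‖((W c : SU N) : Matrix (Fin N) (Fin N) ℂ) -
        ((Averaging.iter (fun i => blockAvg (P := P) (j := i) (expMeanLogSU (n := Fin N))) n U c : SU N) : Matrix (Fin N) (Fin N) ℂ)‖ ≤ η) →
      (∀ c : PBond P n, c ∉ T n → W c = Averaging.iter (fun i => blockAvg (P := P) (j := i) (expMeanLogSU (n := Fin N))) n U c) →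
    ∃ U' : GaugeField P 0 (SU N),
      Averaging.iter (fun i => blockAvg (P := P) (j := i) (expMeanLogSU (n := Fin N))) n U' = W ∧
      (∀ i, i ≤ n → ∀ c : PBond P i, c ∉ T i →
        Averaging.iter (fun i => blockAvg (P := P) (j := i) (expMeanLogSU (n := Fin N))) i U' c =
          Averaging.iter (fun i => blockAvg (P := P) (j := i) (expMeanLogSU (n := Fin N))) i U c) ∧
      ∀ b : PBond P 0, ‖((U' b : SU N) : Matrix (Fin N) (Fin N) ℂ) - (U b : Matrix (Fin N) (Fin N) ℂ)‖ ≤ (2 / emlWeight P) ^ n * η := by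
  intro n
  induction n with
  | zero =>
    intro _ U _ T _ η _ _ _ W hW hWT
    refine ⟨W, rfl, fun i hi c hc => ?_, fun b => ?_⟩
    · obtain rfl : i = 0 := Nat.le_zero.mp hi
      exact hWT c hc
    · rw [pow_zero, one_mul]
      exact hW b
  | succ n ih =>
    intro hn U hsm T hT η hη hsmall hguard W hW hWT
    have hκ : 0 < emlWeight P := emlWeight_pos P
    have hκ1 : emlWeight P ≤ 1 := emlWeight_le_one P
    have hst : 0 ≤ stokesConst P * t := mul_nonneg (stokesConst_nonneg P) ht
    have hq1 : 1 ≤ 2 / emlWeight P := by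
      rw [le_div_iff₀ hκ]; linarith
    have hqn : 1 ≤ (2 / emlWeight P) ^ n := one_le_pow₀ hq1
    have hpow : (2 / emlWeight P) ^ (n + 1) * η = (2 / emlWeight P) ^ n * (2 * η / emlWeight P) := by
      rw [pow_succ]; ring
    have h1 : 2 * η / emlWeight P ≤ (2 / emlWeight P) ^ (n + 1) * η := by
      rw [hpow]
      have : 0 ≤ 2 * η / emlWeight P := div_nonneg (by linarith) hκ.le
      nlinarith
    have hsmall₁ : stokesConst P * t + 2 * η / emlWeight P ≤ emlWeight P / 16 := by linarith
    have hguard₁ : stokesConst P * t + 2 * η / emlWeight P < (expMeanLogSU (n := Fin N)).δ := by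
      show _ < deltaSU (Fin N)
      linarith
    set Λ : GaugeField P n (SU N) := Averaging.iter (fun i => blockAvg (P := P) (j := i) (expMeanLogSU (n := Fin N))) n U with hΛ
    have hΛsmall : PlaqSmall t Λ := hsm n (Nat.lt_succ_self n)
    have hWΛ : ∀ c, ‖((W c : SU N) : Matrix (Fin N) (Fin N) ℂ) - ((avgFun (expMeanLogSU (n := Fin N)) Λ c : SU N) : Matrix (Fin N) (Fin N) ℂ)‖ ≤ η := by
      intro c
      have := hW c
      rwa [iter_succ_eq_avgFun_rec] at this
    obtain ⟨μ, hμW, hμoff, hμsel, hμdist⟩ :=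
      exists_avgFun_eq_of_near_selective (n := Fin N) hn ht hη hsmall₁ hguard₁ Λ hΛsmall W hWΛ
    have hμT : ∀ c : PBond P n, c ∉ T n → μ c = Λ c := by
      intro c hc
      by_cases hcen : ∃ c' : PBond P (n + 1), centralBond c' = c
      · obtain ⟨c', rfl⟩ := hcen
        have hc' : c' ∉ T (n + 1) := fun h => hc (hT n (Nat.lt_succ_self n) c' h)
        refine hμsel c' ?_
        rw [hWT c' hc', iter_succ_eq_avgFun_rec]
      · push Not at hcen
        exact hμoff c fun c' h => hcen c' h
    have hsmall' : stokesConst P * t + (2 / emlWeight P) ^ n * (2 * η / emlWeight P) ≤ emlWeight P / 16 := by rwa [← hpow]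
    have hguard' : stokesConst P * t + (2 / emlWeight P) ^ n * (2 * η / emlWeight P) < deltaSU (Fin N) := by rwa [← hpow]
    obtain ⟨U', hU'iter, hU'off, hU'dist⟩ := ih (Nat.le_of_succ_le hn) U (fun i hi => hsm i (Nat.lt_succ_of_lt hi)) T
      (fun i hi => hT i (Nat.lt_succ_of_lt hi)) (2 * η / emlWeight P) (div_nonneg (by linarith) hκ.le) hsmall' hguard' μ hμdist hμT
    refine ⟨U', ?_, fun i hi c hc => ?_, fun b => ?_⟩
    · rw [iter_succ_eq_avgFun_rec, hU'iter, hμW]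
    · rcases Nat.lt_or_eq_of_le hi with hi' | rfl
      · exact hU'off i (Nat.le_of_lt_succ hi') c hc
      · rw [iter_succ_eq_avgFun_rec, hU'iter, hμW, hWT c hc]
    · rw [hpow]; exact hU'dist b

end Summit.QuantumFields.YangMills.BalabanUVNodes.N07CritSelectiveCorrector

end
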